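import Summits.NavierStokesRegularity.NavierStokesRegularity.Theorems.PoloidalWindowDoorPoloidalWindowRigidityZShockRotatingProfileRiemann
import Summits.NavierStokesRegularity.NavierStokesRegularity.Theorems.PoloidalWindowDoorPoloidalWindowRigidityZShockRotatingProfileRiemannSource
import HarnessLib

/-!
# Crux K2 `PoloidalWindowRigidity` (stmt-NavierStokesRegularity-19708), line `z_shock` — R3 inhabitant census: ROTATING PATTERNS (XVI) —
# the RIEMANN LAW of a rotating profile in the hyperbolic exterior: transport of `w₊` = explicit quadratic form in `(w₊, w₋)` with
# Riccati self-interaction `−γ'(Ψ)(1/λ² + 1/γ(Ψ)²)/4 · w₊²` (parts XIII + XIV composed; census items F3/F4)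

`--supports stmt-NavierStokesRegularity-19708 --as helper` (leafhand-ns-poloidalwindowdoor-3 g9, cell decomp-ns, 2026-08-31).  Class-free,
def-free; parts XIII (`…RotatingProfileRiemann`), XIV (`…RotatingProfileRiemannSource`).  **No stub and no summit is closed by this file;
Navier–Stokes regularity is NOT proved here (rung 0).**

* ★ `rotating_riemann_law` — for a `C²` solution of `ω² ΘΘΨ = Σᵢ∂ᵢ(γ(Ψ)∂ᵢΨ)` with `γ ∈ C¹`, `γ > 0`, `γ' =` the derivative of `γ`, at every
  point with `γ(Ψ(y)) < ω²|y|²`: writing `p = γ(Ψ)XΨ`, `q = ΘΨ`, `λ = √((ω²|y|² − γ(Ψ))γ(Ψ))`, `w± = p ± λq`, `L₁ = Xλ`, `L₂ = Θλ`, `g = γ'(Ψ)`,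
  `X w₊ − (λ/γ(Ψ)) Θ w₊ = −(g/4)(1/λ² + 1/γ(Ψ)²)·w₊² + (g/(2λ²))·w₊w₋ − (g/4)(1/λ² − 1/γ(Ψ)²)·w₋² + ((L₁ − λL₂/γ(Ψ))/(2λ))·(w₊ − w₋)`.
  This is the law census item F4 integrates along the outgoing characteristics (`…ZShockRiccatiForced`): a Riccati self-term of the THICK sign,
  cross/incoming terms, and the linear geometric term.  Everything is stated with nested `fderiv`s at the point (no definitions).

[folklore] (John 1974 §2)
-/

noncomputable section

namespace Summit.NavierStokesRegularity.NavierStokesRegularity.Theorems.PoloidalWindowDoorPoloidalWindowRigidityZShockRotatingProfileRiemannLaw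

-- the summit and its single sub-problem share the name (CONVENTIONS §1)
set_option linter.dupNamespace false

open Set Filter Topology
open Summit.NavierStokesRegularity.NavierStokesRegularity.Theorems.PoloidalWindowDoorPoloidalWindowRigidityZShockRotatingProfileRiemann Summit.NavierStokesRegularity.NavierStokesRegularity.Theorems.PoloidalWindowDoorPoloidalWindowRigidityZShockRotatingProfileRiemannSource

variable {Ψ : EuclideanSpace ℝ (Fin 2) → ℝ} {γ γ' : ℝ → ℝ} {J : EuclideanSpace ℝ (Fin 2) → EuclideanSpace ℝ (Fin 2)} {ω : ℝ}

/-- ★ **The Riemann law of a rotating profile in the hyperbolic exterior** (transport of `w₊` as a quadratic form in `w±`). [folklore] -/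
theorem rotating_riemann_law (hΨ : ContDiff ℝ 2 Ψ) (hγ : ContDiff ℝ 1 γ) (hγ' : ∀ r, HasDerivAt γ (γ' r) r)
    (hJ : ∀ y' : EuclideanSpace ℝ (Fin 2), J y' = (-(y' 1)) • EuclideanSpace.single (0 : Fin 2) (1 : ℝ) +
      (y' 0) • EuclideanSpace.single (1 : Fin 2) (1 : ℝ))
    (hrot : ∀ y : EuclideanSpace ℝ (Fin 2),
      ω ^ 2 * fderiv ℝ (fun y' => fderiv ℝ Ψ y' (J y')) y (J y) =
        ∑ i, fderiv ℝ (fun y' => γ (Ψ y') * fderiv ℝ Ψ y' (EuclideanSpace.single i 1)) y (EuclideanSpace.single i 1))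
    (hγpos : ∀ r, 0 < γ r) (y : EuclideanSpace ℝ (Fin 2)) (hext : γ (Ψ y) < ω ^ 2 * ‖y‖ ^ 2) :
    fderiv ℝ (fun y' : EuclideanSpace ℝ (Fin 2) => γ (Ψ y') * fderiv ℝ Ψ y' y' + Real.sqrt ((ω ^ 2 * ‖y'‖ ^ 2 - γ (Ψ y')) * γ (Ψ y')) * fderiv ℝ Ψ y' (J y')) y y - Real.sqrt ((ω ^ 2 * ‖y‖ ^ 2 - γ (Ψ y)) * γ (Ψ y)) / γ (Ψ y) * fderiv ℝ (fun y' : EuclideanSpace ℝ (Fin 2) => γ (Ψ y') * fderiv ℝ Ψ y' y' + Real.sqrt ((ω ^ 2 * ‖y'‖ ^ 2 - γ (Ψ y')) * γ (Ψ y')) * fderiv ℝ Ψ y' (J y')) y (J y) =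
      -(γ' (Ψ y) / 4 * (1 / Real.sqrt ((ω ^ 2 * ‖y‖ ^ 2 - γ (Ψ y)) * γ (Ψ y)) ^ 2 + 1 / γ (Ψ y) ^ 2)) * ((γ (Ψ y) * fderiv ℝ Ψ y y) + Real.sqrt ((ω ^ 2 * ‖y‖ ^ 2 - γ (Ψ y)) * γ (Ψ y)) * fderiv ℝ Ψ y (J y)) ^ 2
        + γ' (Ψ y) / (2 * Real.sqrt ((ω ^ 2 * ‖y‖ ^ 2 - γ (Ψ y)) * γ (Ψ y)) ^ 2) * (((γ (Ψ y) * fderiv ℝ Ψ y y) + Real.sqrt ((ω ^ 2 * ‖y‖ ^ 2 - γ (Ψ y)) * γ (Ψ y)) * fderiv ℝ Ψ y (J y)) * ((γ (Ψ y) * fderiv ℝ Ψ y y) - Real.sqrt ((ω ^ 2 * ‖y‖ ^ 2 - γ (Ψ y)) * γ (Ψ y)) * fderiv ℝ Ψ y (J y)))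
        - γ' (Ψ y) / 4 * (1 / Real.sqrt ((ω ^ 2 * ‖y‖ ^ 2 - γ (Ψ y)) * γ (Ψ y)) ^ 2 - 1 / γ (Ψ y) ^ 2) * ((γ (Ψ y) * fderiv ℝ Ψ y y) - Real.sqrt ((ω ^ 2 * ‖y‖ ^ 2 - γ (Ψ y)) * γ (Ψ y)) * fderiv ℝ Ψ y (J y)) ^ 2
        + (fderiv ℝ (fun y' : EuclideanSpace ℝ (Fin 2) => Real.sqrt ((ω ^ 2 * ‖y'‖ ^ 2 - γ (Ψ y')) * γ (Ψ y'))) y y - Real.sqrt ((ω ^ 2 * ‖y‖ ^ 2 - γ (Ψ y)) * γ (Ψ y)) * fderiv ℝ (fun y' : EuclideanSpace ℝ (Fin 2) => Real.sqrt ((ω ^ 2 * ‖y'‖ ^ 2 - γ (Ψ y')) * γ (Ψ y'))) y (J y) / γ (Ψ y)) / (2 * Real.sqrt ((ω ^ 2 * ‖y‖ ^ 2 - γ (Ψ y)) * γ (Ψ y))) * (((γ (Ψ y) * fderiv ℝ Ψ y y) + Real.sqrt ((ω ^ 2 * ‖y‖ ^ 2 - γ (Ψ y)) * γ (Ψ y))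 * fderiv ℝ Ψ y (J y)) - ((γ (Ψ y) * fderiv ℝ Ψ y y) - Real.sqrt ((ω ^ 2 * ‖y‖ ^ 2 - γ (Ψ y)) * γ (Ψ y)) * fderiv ℝ Ψ y (J y))) := by
  have hΨd : Differentiable ℝ Ψ := hΨ.differentiable two_ne_zero
  have hpos : 0 < (ω ^ 2 * ‖y‖ ^ 2 - γ (Ψ y)) * γ (Ψ y) := mul_pos (sub_pos.2 hext) (hγpos _)
  have hlam : Real.sqrt ((ω ^ 2 * ‖y‖ ^ 2 - γ (Ψ y)) * γ (Ψ y)) ≠ 0 := (Real.sqrt_pos.2 hpos).ne'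
  rw [rotating_riemann_transport hΨ hγ hJ hrot hγpos y hext, rotating_angular_m (ω := ω) hΨ hγ hJ y,
    angular_chain hΨd hγ' y (J y)]
  exact source_in_invariants (γ (Ψ y) * fderiv ℝ Ψ y y) (fderiv ℝ Ψ y (J y)) (Real.sqrt ((ω ^ 2 * ‖y‖ ^ 2 - γ (Ψ y)) * γ (Ψ y))) (γ (Ψ y)) (γ' (Ψ y)) (fderiv ℝ (fun y' : EuclideanSpace ℝ (Fin 2) => Real.sqrt ((ω ^ 2 * ‖y'‖ ^ 2 - γ (Ψ y')) * γ (Ψ y'))) y y) (fderiv ℝ (fun y' : EuclideanSpace ℝ (Fin 2) => Real.sqrt ((ω ^ 2 * ‖y'‖ ^ 2 - γ (Ψ y')) * γ (Ψ y'))) y (J y)) hlam (hγpos _).ne'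

end Summit.NavierStokesRegularity.NavierStokesRegularity.Theorems.PoloidalWindowDoorPoloidalWindowRigidityZShockRotatingProfileRiemannLaw
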